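import Mathlib
import HarnessLib

/-!
# The PERIODIC massive-mode rung, brick PM-IIa(ii): one-variable JET LEMMAS for nonnegative functions and the PSD-kernel lemma
# (free-hands support of ⟨stmt-QuantumFields-24196⟩ `SwapVirialDeficit.ToronSoftnessSharp`; 'LEMMA H / LEMMA C in elementary form' of LEAD ym-line-sfw-p2 g96's PM design
# memo `sfw-p2-g96-memo-24196-PM-design.md` §1/§3, used by PM-IIb: the structure theorem `G = u⁴s²·Φ` of the periodic two-scale chart)

GENERIC real analysis, no ring objects:
* `exists_sign_near_of_hasDerivAt_pos` (E1): `h(0) = 0`, `h′(0) = c > 0` ⟹ `h < 0` on `(−η, 0)` and `h > 0` on `(0, η)`;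
* `neg_of_deriv_neg_Ioo` / `neg_of_deriv_pos_Ioo` (E2): `g(0) = 0` and `g′ < 0` on `(0, η)` (resp. `g′ > 0` on `(−η, 0)`) ⟹ `g < 0` there;
* ★ `deriv_eq_zero_of_nonneg`, ★ `iteratedDeriv_two_nonneg_of_nonneg` (LEMMA H, scalar form: first/second-order necessary conditions at a minimum `g ≥ 0 = g(0)`);
* ★★ `iteratedDeriv_three_eq_zero_of_nonneg` (LEMMA C): a `C³` function `≥ 0` with vanishing 2-jet at `0` has vanishing third derivative at `0`;
* ★ `bilin_apply_eq_zero_of_psd` (PSD kernel lemma: `B` symmetric, `B v v ≥ 0`, `B c c = 0` ⟹ `B c w = 0 ∀ w`) and `psd_null_add` (null vectors add).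
HONEST LABEL: calculus; PM-IIb (the instantiation) is LEAD g96's and NOT proved here; ⟨24196⟩/⟨24497⟩ OPEN; own crux ⟨22884⟩ OPEN (blocked-on ⟨19935⟩);
the Yang–Mills mass gap is NOT proved; no summit is proved by a line.  Width seat ym-line-sfw-p2-w3 g64 (cell ym-idea-1, free hands),
`--supports stmt-QuantumFields-24196`.  THEOREMS ONLY (0 `def`, 0 `sorry`), standard axioms.  References: [folklore] (second/third-order necessary conditions;
Cauchy–Schwarz for positive semidefinite forms); [cite: Luscher1983, §2] for the use.
-/

set_option autoImplicit false

noncomputable section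

open Set Filter Topology

namespace Summit.QuantumFields.YangMills.Theorems.SwapVirialDeficit.BlowUp

/-! ## §1 Sign of a function near a simple zero (E1) and one-sided monotonicity (E2) -/

/-- (E1) If `h(0) = 0` and `h′(0) = c > 0` then, on some punctured neighbourhood, `h < 0` to the left and `h > 0` to the right of `0`. [folklore] -/
theorem exists_sign_near_of_hasDerivAt_pos {h : ℝ → ℝ} {c : ℝ} (hh : HasDerivAt h c 0) (h0 : h 0 = 0) (hc : 0 < c) :
    ∃ η : ℝ, 0 < η ∧ (∀ x ∈ Ioo (-η) 0, h x < 0) ∧ ∀ x ∈ Ioo 0 η, 0 < h x := by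
  have ht : Tendsto (slope h 0) (𝓝[≠] 0) (𝓝 c) := hasDerivAt_iff_tendsto_slope.1 hh
  have hev : ∀ᶠ x in 𝓝[≠] (0 : ℝ), 0 < slope h 0 x := ht.eventually (lt_mem_nhds hc)
  obtain ⟨η, hη, hball⟩ := Metric.eventually_nhds_iff.1 (eventually_nhdsWithin_iff.1 hev)
  have hslope : ∀ x : ℝ, x ≠ 0 → |x| < η → 0 < h x / x := by
    intro x hx hxη
    have := hball (y := x) (by rwa [Real.dist_eq, sub_zero]) (by simpa using hx)
    simpa [slope_def_field, h0] using this
  refine ⟨η, hη, fun x hx => ?_, fun x hx => ?_⟩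
  · have hx0 : x < 0 := hx.2
    have := hslope x hx0.ne (by rw [abs_of_neg hx0]; linarith [hx.1])
    exact (div_pos_iff.1 this).resolve_left (fun h' => absurd h'.2 (not_lt.2 hx0.le)) |>.1
  · have hx0 : 0 < x := hx.1
    have := hslope x hx0.ne' (by rw [abs_of_pos hx0]; exact hx.2)
    exact (div_pos_iff.1 this).resolve_right (fun h' => absurd h'.2 (not_lt.2 hx0.le)) |>.1

/-- (E2, right) `g` continuous on `[0, η)`, differentiable with `g′ < 0` on `(0, η)`, `g(0) = 0` ⟹ `g < 0` on `(0, η)`. [folklore] -/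
theorem neg_of_deriv_neg_Ioo {g : ℝ → ℝ} {η : ℝ} (hgc : Continuous g) (hg0 : g 0 = 0) (hd : ∀ x ∈ Ioo 0 η, deriv g x < 0) :
    ∀ x ∈ Ioo 0 η, g x < 0 := by
  intro x hx
  have hanti : StrictAntiOn g (Icc 0 x) := by
    refine strictAntiOn_of_deriv_neg (convex_Icc 0 x) hgc.continuousOn fun y hy => ?_
    rw [interior_Icc] at hy
    exact hd y ⟨hy.1, hy.2.trans hx.2⟩
  have := hanti (left_mem_Icc.2 hx.1.le) (right_mem_Icc.2 hx.1.le) hx.1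
  rwa [hg0] at this

/-- (E2, left) `g` continuous, `g′ > 0` on `(−η, 0)`, `g(0) = 0` ⟹ `g < 0` on `(−η, 0)`. [folklore] -/
theorem neg_of_deriv_pos_Ioo {g : ℝ → ℝ} {η : ℝ} (hgc : Continuous g) (hg0 : g 0 = 0) (hd : ∀ x ∈ Ioo (-η) 0, 0 < deriv g x) :
    ∀ x ∈ Ioo (-η) 0, g x < 0 := by
  intro x hx
  have hmono : StrictMonoOn g (Icc x 0) := by
    refine strictMonoOn_of_deriv_pos (convex_Icc x 0) hgc.continuousOn fun y hy => ?_
    rw [interior_Icc] at hy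
    exact hd y ⟨hx.1.trans hy.1, hy.2⟩
  have := hmono (left_mem_Icc.2 hx.2.le) (right_mem_Icc.2 hx.2.le) hx.2
  rwa [hg0] at this

/-- (E2, combined) `g′(0) = 0`-type bootstrap: if `g` is `C¹`, `g(0) = 0`, and `deriv g` is `< 0` on `(0,η)`, then `g` takes a negative value. [folklore] -/
theorem exists_neg_of_deriv_neg_Ioo {g : ℝ → ℝ} {η : ℝ} (hη : 0 < η) (hgc : Continuous g) (hg0 : g 0 = 0) (hd : ∀ x ∈ Ioo 0 η, deriv g x < 0) :
    ∃ x, g x < 0 :=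
  ⟨η / 2, neg_of_deriv_neg_Ioo hgc hg0 hd (η / 2) ⟨by positivity, by linarith⟩⟩

/-! ## §2 Necessary conditions at a minimum: LEMMA H (scalar) and LEMMA C -/

/-- First-order condition: `g ≥ 0 = g(0)` ⟹ `g′(0) = 0`. [folklore] -/
theorem deriv_eq_zero_of_nonneg {g : ℝ → ℝ} (h0 : ∀ x, 0 ≤ g x) (hg0 : g 0 = 0) : deriv g 0 = 0 :=
  IsLocalMin.deriv_eq_zero (Filter.Eventually.of_forall fun x => by rw [hg0]; exact h0 x)

/-- ★ LEMMA H (scalar form), second-order condition: a `C²` function `g ≥ 0` with `g(0) = 0` has `g″(0) ≥ 0`. [folklore] -/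
theorem iteratedDeriv_two_nonneg_of_nonneg {g : ℝ → ℝ} (hg : ContDiff ℝ 2 g) (h0 : ∀ x, 0 ≤ g x) (hg0 : g 0 = 0) : 0 ≤ iteratedDeriv 2 g 0 := by
  by_contra hneg
  push Not at hneg
  have hgc : Continuous g := hg.continuous
  have hd1 : Differentiable ℝ (deriv g) := by
    have := hg.differentiable_iteratedDeriv 1 (by norm_cast); rwa [iteratedDeriv_one] at this
  have hder : HasDerivAt (fun x => -deriv g x) (-iteratedDeriv 2 g 0) 0 := by
    have h := (hd1 0).hasDerivAt
    rw [show deriv (deriv g) 0 = iteratedDeriv 2 g 0 by rw [iteratedDeriv_succ, iteratedDeriv_one]] at h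
    exact h.neg
  obtain ⟨η, hη, -, hright⟩ := exists_sign_near_of_hasDerivAt_pos hder (by simp [deriv_eq_zero_of_nonneg h0 hg0]) (by linarith)
  obtain ⟨x, hx⟩ := exists_neg_of_deriv_neg_Ioo hη hgc hg0 fun x hx => by linarith [hright x hx]
  exact absurd (h0 x) (not_le.2 hx)

/-- ★★ LEMMA C: a `C³` function `g ≥ 0` with `g(0) = g′(0) = g″(0) = 0` has `g‴(0) = 0` (else `g(ε) = g‴(0)ε³/6 + o(ε³)` changes sign). [folklore] -/
theorem iteratedDeriv_three_eq_zero_of_nonneg {g : ℝ → ℝ} (hg : ContDiff ℝ 3 g) (h0 : ∀ x, 0 ≤ g x) (hg0 : g 0 = 0)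
    (hg2 : iteratedDeriv 2 g 0 = 0) : iteratedDeriv 3 g 0 = 0 := by
  have hgc : Continuous g := hg.continuous
  have hg1 : deriv g 0 = 0 := deriv_eq_zero_of_nonneg h0 hg0
  have hd1c : Continuous (deriv g) := by
    have := hg.continuous_iteratedDeriv 1 (by norm_cast); rwa [iteratedDeriv_one] at this
  have hd2 : Differentiable ℝ (iteratedDeriv 2 g) := hg.differentiable_iteratedDeriv 2 (by norm_cast)
  have h2eq : iteratedDeriv 2 g = deriv (deriv g) := by rw [iteratedDeriv_succ, iteratedDeriv_one]
  -- `h := g″` has `h(0) = 0`, `h′(0) = g‴(0)`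
  have hder : HasDerivAt (iteratedDeriv 2 g) (iteratedDeriv 3 g 0) 0 := by
    have h := (hd2 0).hasDerivAt; rwa [← iteratedDeriv_succ] at h
  -- `deriv g` is strictly monotone where `g″` has a sign: `g′(0) = 0` then forces a sign of `g′`, then of `g`
  have hderiv_g' : ∀ y, deriv (deriv g) y = iteratedDeriv 2 g y := fun y => by rw [h2eq]
  by_contra hne
  rcases lt_or_gt_of_ne hne with hlt | hgt
  · -- `g‴(0) < 0`: `g″ < 0` on `(0,η)` ⟹ `g′ < 0` on `(0,η)` ⟹ `g < 0` there
    obtain ⟨η, hη, -, hright⟩ := exists_sign_near_of_hasDerivAt_pos hder.neg (by simp [hg2]) (by linarith)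
    have hg'neg : ∀ x ∈ Ioo 0 η, deriv g x < 0 :=
      neg_of_deriv_neg_Ioo hd1c hg1 fun y hy => by
        have h' := hright y hy; simp only [Pi.neg_apply] at h'; rw [hderiv_g']; linarith
    obtain ⟨x, hx⟩ := exists_neg_of_deriv_neg_Ioo hη hgc hg0 hg'neg
    exact absurd (h0 x) (not_le.2 hx)
  · -- `g‴(0) > 0`: `g″ < 0` on `(−η,0)` ⟹ `g′` strictly decreasing there with `g′(0) = 0` ⟹ `g′ > 0` ⟹ `g` increasing to `g(0) = 0` ⟹ `g < 0`
    obtain ⟨η, hη, hleft, -⟩ := exists_sign_near_of_hasDerivAt_pos hder hg2 hgt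
    have hg'pos : ∀ x ∈ Ioo (-η) 0, 0 < deriv g x := by
      intro x hx
      -- `−g′` vanishes at 0 and has derivative `−g″ > 0` on `(−η,0)` ⟹ `−g′ < 0` on `(−η,0)`
      have := neg_of_deriv_pos_Ioo (g := fun y => -deriv g y) hd1c.neg (by simp [hg1])
        (fun y hy => by rw [show (fun y => -deriv g y) = -deriv g from rfl, deriv.neg, hderiv_g']; linarith [hleft y hy]) x hx
      linarith
    have hx := neg_of_deriv_pos_Ioo hgc hg0 hg'pos (-(η / 2)) ⟨by linarith, by linarith⟩
    exact absurd (h0 _) (not_le.2 hx)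

/-! ## §3 The PSD-kernel lemma (null vectors of a positive semidefinite form) -/

/-- ★ Cauchy–Schwarz degenerate case: for a symmetric positive semidefinite bilinear form, `B c c = 0 ⟹ B c w = 0` for all `w`
(`0 ≤ B(c + t w)(c + t w) = 2t·B c w + t²·B w w` for all real `t`). [folklore] -/
theorem bilin_apply_eq_zero_of_psd {E : Type*} [AddCommGroup E] [Module ℝ E] (B : E →ₗ[ℝ] E →ₗ[ℝ] ℝ)
    (hsymm : ∀ v w, B v w = B w v) (hpsd : ∀ v, 0 ≤ B v v) {c : E} (hc : B c c = 0) (w : E) : B c w = 0 := by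
  have hq : ∀ t : ℝ, 0 ≤ 2 * t * B c w + t ^ 2 * B w w := by
    intro t
    have h := hpsd (c + t • w)
    simp only [map_add, map_smul, LinearMap.add_apply, LinearMap.smul_apply, smul_eq_mul, hc, hsymm w c] at h
    nlinarith [h]
  by_contra hne
  rcases lt_or_gt_of_ne hne with hlt | hgt
  · -- take `t > 0` small… simpler: `t := -(B c w)/(B w w + 1)`-free argument via two signs
    by_cases hw : B w w ≤ 0
    · have := hq 1; nlinarith
    · push Not at hw
      have := hq (-(B c w) / B w w)
      have hB : 0 < B w w := hw
      field_simp at this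
      nlinarith [sq_nonneg (B c w), this, hB, sq_pos_of_neg hlt]
  · by_cases hw : B w w ≤ 0
    · have := hq (-1); nlinarith
    · push Not at hw
      have := hq (-(B c w) / B w w)
      have hB : 0 < B w w := hw
      field_simp at this
      nlinarith [sq_nonneg (B c w), this, hB, sq_pos_of_pos hgt]

/-- Null vectors of a symmetric PSD form add: `B c₁ c₁ = 0 = B c₂ c₂ ⟹ B (c₁ + c₂) (c₁ + c₂) = 0` (the 'leader directions are jointly null' step). [folklore] -/
theorem psd_null_add {E : Type*} [AddCommGroup E] [Module ℝ E] (B : E →ₗ[ℝ] E →ₗ[ℝ] ℝ)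
    (hsymm : ∀ v w, B v w = B w v) (hpsd : ∀ v, 0 ≤ B v v) {c₁ c₂ : E} (h₁ : B c₁ c₁ = 0) (h₂ : B c₂ c₂ = 0) :
    B (c₁ + c₂) (c₁ + c₂) = 0 := by
  have ha := bilin_apply_eq_zero_of_psd B hsymm hpsd h₁ (c₁ + c₂)
  have hb := bilin_apply_eq_zero_of_psd B hsymm hpsd h₂ (c₁ + c₂)
  rw [map_add, hsymm (c₁ + c₂) c₁, hsymm (c₁ + c₂) c₂, ha, hb, add_zero]

/-- Null vectors of a symmetric PSD form are stable under scalars and finite sums: `∑ aᵢcᵢ` is null when every `cᵢ` is. [folklore] -/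
theorem psd_null_sum {E : Type*} [AddCommGroup E] [Module ℝ E] (B : E →ₗ[ℝ] E →ₗ[ℝ] ℝ)
    (hsymm : ∀ v w, B v w = B w v) (hpsd : ∀ v, 0 ≤ B v v) {ι : Type*} (s : Finset ι) (c : ι → E) (a : ι → ℝ)
    (hc : ∀ i ∈ s, B (c i) (c i) = 0) : B (∑ i ∈ s, a i • c i) (∑ i ∈ s, a i • c i) = 0 := by
  have hnull : ∀ i ∈ s, ∀ w, B (c i) w = 0 := fun i hi w => bilin_apply_eq_zero_of_psd B hsymm hpsd (hc i hi) w
  rw [map_sum]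
  refine Finset.sum_eq_zero fun i hi => ?_
  rw [map_smul, smul_eq_mul, hsymm _ (c i), hnull i hi, mul_zero]

end Summit.QuantumFields.YangMills.Theorems.SwapVirialDeficit.BlowUp

end
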